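import Summits.CriticalPhenomena.CardyFormulaZ2.Theorems.CardyFlipRussoSquareFromVoronoiHubProductLegDefs
import HarnessLib

/-!
# A face of the disc-jittered square lattice is almost surely not concyclic

Helper for crux stmt-CriticalPhenomena-6434
(`Summit.CriticalPhenomena.CardyFormulaZ2.Theses.CardyFlipRusso.SquareFromVoronoiHub`), line
`SketchIdeator5R2`, stub `stub_concyclicFace_null`: under the i.i.d. jitter law
`Measure.infinitePi (fun _ => jitterLaw)` the four jittered corners of a fixed face of `ℤ²` are
almost surely not concyclic (so almost surely the face carries exactly one Delaunay diagonal).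
Proof: concyclic corners annihilate the `3 × 3` concyclicity determinant, an affine function of
`(|C - A|², (C - A).re, (C - A).im)` whose leading coefficient (twice the oriented area of the
triangle `A, B, D`) is positive once the jitters are `≤ 1/20`; the jitter of `C` is independent
of the other three (`iIndepFun_infinitePi`), for fixed `A, B, D` the zero set in `C` is a circle,
Lebesgue-null (`Measure.addHaar_sphere`) hence `jitterLaw`-null, and Fubini
(`Measure.measure_prod_null_of_ae_null`) concludes.
-/

noncomputable section

open scoped Topology MeasureTheory ENNReal
open Filter Set MeasureTheory Metric ProbabilityTheory

namespace Summit.CriticalPhenomena.CardyFormulaZ2.Cruxes.SquareFromVoronoiHub.ProductLeg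

/-! ### Readable local names (NOT definitions; they print unfolded)

`kA[A, B, D] = (B - A) × (D - A)` is twice the oriented area of the triangle `A, B, D`;
`kR[A, B, D]` and `kI[A, B, D]` are the two other cofactors, and
`cyc[A, B, C, D] = kA · |C - A|² + kR · (C - A).re + kI · (C - A).im` is the concyclicity form:
the determinant of the `3 × 3` matrix with rows `(|X - A|², (X - A).re, (X - A).im)`,
`X = B, C, D`, expanded along the row of `C`. -/

/-- Twice the oriented area of the triangle `A, B, D` (local notation). [folklore] -/
local notation3 (prettyPrint := false) "kA[" A ", " B ", " D "]" =>
  ((Complex.re B - Complex.re A) * (Complex.im D - Complex.im A)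
    - (Complex.im B - Complex.im A) * (Complex.re D - Complex.re A))

/-- The cofactor multiplying `(C - A).re` in the concyclicity form (local notation). [folklore] -/
local notation3 (prettyPrint := false) "kR[" A ", " B ", " D "]" =>
  ((Complex.im B - Complex.im A) * ((Complex.re D - Complex.re A) ^ 2
      + (Complex.im D - Complex.im A) ^ 2)
    - ((Complex.re B - Complex.re A) ^ 2 + (Complex.im B - Complex.im A) ^ 2)
      * (Complex.im D - Complex.im A))

/-- The cofactor multiplying `(C - A).im` in the concyclicity form (local notation). [folklore] -/
local notation3 (prettyPrint := false) "kI[" A ", " B ", " D "]" =>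
  (((Complex.re B - Complex.re A) ^ 2 + (Complex.im B - Complex.im A) ^ 2)
      * (Complex.re D - Complex.re A)
    - (Complex.re B - Complex.re A) * ((Complex.re D - Complex.re A) ^ 2
      + (Complex.im D - Complex.im A) ^ 2))

/-- The concyclicity form of `A, B, C, D` (local notation). [folklore] -/
local notation3 (prettyPrint := false) "cyc[" A ", " B ", " C ", " D "]" =>
  (kA[A, B, D] * ((Complex.re C - Complex.re A) ^ 2 + (Complex.im C - Complex.im A) ^ 2)
    + kR[A, B, D] * (Complex.re C - Complex.re A) + kI[A, B, D] * (Complex.im C - Complex.im A))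

/-! ### Plane geometry: the concyclicity form -/

/-- The squared distance of two complex numbers in coordinates. [folklore] -/
private theorem dist_sq_eq_re_im (z w : ℂ) :
    dist z w ^ 2 = (z.re - w.re) ^ 2 + (z.im - w.im) ^ 2 := by
  rw [Complex.dist_eq_re_im, Real.sq_sqrt (by positivity)]

/-- Four concyclic points annihilate the concyclicity form (the rows `(|X - A|², (X - A).re,
(X - A).im)`, `X = B, C, D`, of a circle through `A` are linearly dependent). [folklore] -/
private theorem cyc_eq_zero_of_concyclic {A B C D c : ℂ} {r : ℝ} (hA : dist A c = r)
    (hB : dist B c = r) (hC : dist C c = r) (hD : dist D c = r) : cyc[A, B, C, D] = 0 := by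
  have eA : (A.re - c.re) ^ 2 + (A.im - c.im) ^ 2 = r ^ 2 := by rw [← dist_sq_eq_re_im, hA]
  have eB : (B.re - c.re) ^ 2 + (B.im - c.im) ^ 2 = r ^ 2 := by rw [← dist_sq_eq_re_im, hB]
  have eC : (C.re - c.re) ^ 2 + (C.im - c.im) ^ 2 = r ^ 2 := by rw [← dist_sq_eq_re_im, hC]
  have eD : (D.re - c.re) ^ 2 + (D.im - c.im) ^ 2 = r ^ 2 := by rw [← dist_sq_eq_re_im, hD]
  linear_combination
    ((B.re - A.re) * (D.im - A.im) - (B.im - A.im) * (D.re - A.re)) * (eC - eA)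
      + ((B.im - A.im) * (C.re - A.re) - (B.re - A.re) * (C.im - A.im)) * (eD - eA)
      + ((D.re - A.re) * (C.im - A.im) - (D.im - A.im) * (C.re - A.re)) * (eB - eA)

/-- A zero `C` of `k₀ |C - A|² + k₁ (C - A).re + k₂ (C - A).im` with `k₀ ≠ 0` lies on the circle
through `A` centred at `A - (k₁ + k₂ I) / (2 k₀)` (completing the square). [folklore] -/
private theorem dist_centre_eq {A C : ℂ} {k₀ k₁ k₂ : ℝ} (hk : k₀ ≠ 0)
    (hC : k₀ * ((C.re - A.re) ^ 2 + (C.im - A.im) ^ 2) + k₁ * (C.re - A.re)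
      + k₂ * (C.im - A.im) = 0) :
    dist C ⟨A.re - k₁ / (2 * k₀), A.im - k₂ / (2 * k₀)⟩
      = dist A ⟨A.re - k₁ / (2 * k₀), A.im - k₂ / (2 * k₀)⟩ := by
  have ht1 : 2 * k₀ * (k₁ / (2 * k₀)) = k₁ := by field_simp
  have ht2 : 2 * k₀ * (k₂ / (2 * k₀)) = k₂ := by field_simp
  have key : k₀ * (dist C ⟨A.re - k₁ / (2 * k₀), A.im - k₂ / (2 * k₀)⟩ ^ 2
        - dist A ⟨A.re - k₁ / (2 * k₀), A.im - k₂ / (2 * k₀)⟩ ^ 2)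
      = k₀ * ((C.re - A.re) ^ 2 + (C.im - A.im) ^ 2) + k₁ * (C.re - A.re)
          + k₂ * (C.im - A.im) := by
    rw [dist_sq_eq_re_im, dist_sq_eq_re_im]
    dsimp only
    linear_combination (C.re - A.re) * ht1 + (C.im - A.im) * ht2
  rw [hC, mul_eq_zero] at key
  have h2 : dist C ⟨A.re - k₁ / (2 * k₀), A.im - k₂ / (2 * k₀)⟩ ^ 2
      = dist A ⟨A.re - k₁ / (2 * k₀), A.im - k₂ / (2 * k₀)⟩ ^ 2 := by
    rcases key with h | h
    · exact absurd h hk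
    · linarith
  exact (pow_left_inj₀ dist_nonneg dist_nonneg two_ne_zero).1 h2

/-- For jitters of norm `≤ jitterRadius = 1/20` the triangle on the jittered corners
`P, P + 1, P + I` stays non-degenerate (its doubled oriented area exceeds `7/10`). [folklore] -/
private theorem kA_ne_zero {P α β δ : ℂ} (hα : ‖α‖ ≤ jitterRadius) (hβ : ‖β‖ ≤ jitterRadius)
    (hδ : ‖δ‖ ≤ jitterRadius) : kA[P + α, P + 1 + β, P + Complex.I + δ] ≠ 0 := by
  unfold jitterRadius at hα hβ hδ
  have h1 := abs_le.1 ((Complex.abs_re_le_norm α).trans hα)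
  have h2 := abs_le.1 ((Complex.abs_im_le_norm α).trans hα)
  have h3 := abs_le.1 ((Complex.abs_re_le_norm β).trans hβ)
  have h4 := abs_le.1 ((Complex.abs_im_le_norm β).trans hβ)
  have h5 := abs_le.1 ((Complex.abs_re_le_norm δ).trans hδ)
  have h6 := abs_le.1 ((Complex.abs_im_le_norm δ).trans hδ)
  have hpos : 0 < kA[P + α, P + 1 + β, P + Complex.I + δ] := by
    simp only [Complex.add_re, Complex.add_im, Complex.one_re, Complex.one_im, Complex.I_re,
      Complex.I_im, add_zero]
    nlinarith [mul_nonneg (by linarith : (0 : ℝ) ≤ β.re - α.re + 1 / 10)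
        (by linarith : (0 : ℝ) ≤ δ.im - α.im + 1 / 10),
      mul_nonneg (by linarith : (0 : ℝ) ≤ 1 / 10 - (β.im - α.im))
        (by linarith : (0 : ℝ) ≤ 1 / 10 + (δ.re - α.re))]
  exact hpos.ne'

/-! ### Null sections -/

/-- For `k₀ ≠ 0` the translates `z` with `k₀ |P + z - A|² + k₁ (P + z - A).re + k₂ (P + z - A).im
= 0` form a Lebesgue-null set (a translate of a circle). [folklore] -/
private theorem volume_form_null {A : ℂ} {k₀ k₁ k₂ : ℝ} (hk : k₀ ≠ 0) (P : ℂ) :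
    volume {z : ℂ | k₀ * (((P + z).re - A.re) ^ 2 + ((P + z).im - A.im) ^ 2)
      + k₁ * ((P + z).re - A.re) + k₂ * ((P + z).im - A.im) = 0} = 0 := by
  have hsub : {z : ℂ | k₀ * (((P + z).re - A.re) ^ 2 + ((P + z).im - A.im) ^ 2)
        + k₁ * ((P + z).re - A.re) + k₂ * ((P + z).im - A.im) = 0}
      ⊆ (fun z => P + z) ⁻¹' sphere (⟨A.re - k₁ / (2 * k₀), A.im - k₂ / (2 * k₀)⟩ : ℂ)
          (dist A ⟨A.re - k₁ / (2 * k₀), A.im - k₂ / (2 * k₀)⟩) :=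
    fun z hz => dist_centre_eq hk hz
  refine measure_mono_null hsub ?_
  rw [measure_preimage_add]
  exact Measure.addHaar_sphere volume _ _

/-- The same set is `jitterLaw`-null, since `jitterLaw ≪ volume`. [folklore] -/
private theorem jitterLaw_form_null {A : ℂ} {k₀ k₁ k₂ : ℝ} (hk : k₀ ≠ 0) (P : ℂ) :
    jitterLaw {z : ℂ | k₀ * (((P + z).re - A.re) ^ 2 + ((P + z).im - A.im) ^ 2)
      + k₁ * ((P + z).re - A.re) + k₂ * ((P + z).im - A.im) = 0} = 0 :=
  cond_absolutelyContinuous (volume_form_null hk P)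

/-! ### The i.i.d. jitter law: marginals and independence -/

/-- Under the i.i.d. jitter law every single jitter lies in the closed disc of radius
`jitterRadius` almost surely. [folklore] -/
private theorem ae_jitter_mem (i : ℤ × ℤ) :
    ∀ᵐ ξ ∂(Measure.infinitePi (fun _ : ℤ × ℤ => jitterLaw)),
      ξ i ∈ closedBall (0 : ℂ) jitterRadius := by
  have h : ∀ᵐ z ∂jitterLaw, z ∈ closedBall (0 : ℂ) jitterRadius :=
    ae_cond_mem measurableSet_closedBall
  rw [← Measure.infinitePi_map_eval (fun _ : ℤ × ℤ => jitterLaw) i] at h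
  exact ae_of_ae_map (measurable_pi_apply i).aemeasurable h

/-- Under the i.i.d. jitter law, the jitters at three sites are jointly independent of the jitter
at a fourth site. [folklore] -/
private theorem indepFun_three_one {a b d e : ℤ × ℤ} (ha : a ≠ e) (hb : b ≠ e) (hd : d ≠ e) :
    IndepFun (fun ξ : ℤ × ℤ → ℂ => (ξ a, ξ b, ξ d)) (fun ξ => ξ e)
      (Measure.infinitePi (fun _ : ℤ × ℤ => jitterLaw)) := by
  classical
  have hind : iIndepFun (fun i (ξ : ℤ × ℤ → ℂ) => ξ i)
      (Measure.infinitePi (fun _ : ℤ × ℤ => jitterLaw)) :=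
    iIndepFun_infinitePi (P := fun _ : ℤ × ℤ => jitterLaw) (X := fun _ x => x)
      (fun _ => measurable_id)
  have haS : a ∈ ({a, b, d} : Finset (ℤ × ℤ)) := by simp
  have hbS : b ∈ ({a, b, d} : Finset (ℤ × ℤ)) := by simp
  have hdS : d ∈ ({a, b, d} : Finset (ℤ × ℤ)) := by simp
  have hST : Disjoint ({a, b, d} : Finset (ℤ × ℤ)) {e} := by
    rw [Finset.disjoint_singleton_right]
    simp only [Finset.mem_insert, Finset.mem_singleton, not_or]
    exact ⟨ha.symm, hb.symm, hd.symm⟩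
  have h := hind.indepFun_finset ({a, b, d} : Finset (ℤ × ℤ)) {e} hST
    (fun _ => measurable_pi_apply _)
  have hφ : Measurable (fun p : (({a, b, d} : Finset (ℤ × ℤ)) : Type) → ℂ =>
      (p ⟨a, haS⟩, p ⟨b, hbS⟩, p ⟨d, hdS⟩)) := by
    fun_prop
  have hψ : Measurable (fun p : (({e} : Finset (ℤ × ℤ)) : Type) → ℂ =>
      p ⟨e, Finset.mem_singleton_self e⟩) :=
    measurable_pi_apply _
  exact h.comp hφ hψ

/-! ### The stub -/

/-- **Stub `stub_concyclicFace_null`.** Under the i.i.d. disc-jitter law, the four jittered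
corners `v, v + (1,0), v + (1,1), v + (0,1)` of a fixed face of `ℤ²` are almost surely not
concyclic. [folklore] -/
theorem stub_concyclicFace_null :
    ∀ v : ℤ × ℤ, Measure.infinitePi (fun _ : ℤ × ℤ => jitterLaw)
      {ξ | ∃ (c : ℂ) (r : ℝ), dist (sqPos v + ξ v) c = r ∧ dist (sqPos (v.1 + 1, v.2) + ξ (v.1 + 1, v.2)) c = r ∧
        dist (sqPos (v.1 + 1, v.2 + 1) + ξ (v.1 + 1, v.2 + 1)) c = r ∧
        dist (sqPos (v.1, v.2 + 1) + ξ (v.1, v.2 + 1)) c = r} = 0 := by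
  intro v
  set b : ℤ × ℤ := (v.1 + 1, v.2) with hb
  set d : ℤ × ℤ := (v.1, v.2 + 1) with hd
  set e : ℤ × ℤ := (v.1 + 1, v.2 + 1) with he
  have hsb : sqPos b = sqPos v + 1 := by simp only [hb, sqPos]; push_cast; ring
  have hsd : sqPos d = sqPos v + Complex.I := by simp only [hd, sqPos]; push_cast; ring
  have hve : v ≠ e := by simp [he, Prod.ext_iff]
  have hbe : b ≠ e := by simp [hb, he, Prod.ext_iff]
  have hde : d ≠ e := by simp [hd, he, Prod.ext_iff]
  -- the concyclicity form of the face, read on `((ξ v, ξ b, ξ d), ξ e)`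
  let G : (ℂ × ℂ × ℂ) × ℂ → ℝ := fun p =>
    cyc[sqPos v + p.1.1, sqPos b + p.1.2.1, sqPos e + p.2, sqPos d + p.1.2.2]
  have hY : Measurable (fun ξ : ℤ × ℤ → ℂ => (ξ v, ξ b, ξ d)) := by fun_prop
  have hX : Measurable (fun ξ : ℤ × ℤ → ℂ => ξ e) := measurable_pi_apply e
  have hF : Measurable (fun ξ : ℤ × ℤ → ℂ => ((ξ v, ξ b, ξ d), ξ e)) := hY.prodMk hX
  have hcont : Continuous (fun q : ℂ × ℂ × ℂ × ℂ => cyc[q.1, q.2.1, q.2.2.1, q.2.2.2]) := by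
    fun_prop
  have hG : Measurable G :=
    (hcont.comp (by fun_prop : Continuous fun p : (ℂ × ℂ × ℂ) × ℂ =>
      (sqPos v + p.1.1, sqPos b + p.1.2.1, sqPos e + p.2, sqPos d + p.1.2.2))).measurable
  have hs : MeasurableSet (G ⁻¹' {0}) := hG (measurableSet_singleton 0)
  -- Step 1: the event lies in the zero set of the form
  have hsub : {ξ : ℤ × ℤ → ℂ | ∃ (c : ℂ) (r : ℝ), dist (sqPos v + ξ v) c = r ∧
        dist (sqPos b + ξ b) c = r ∧ dist (sqPos e + ξ e) c = r ∧ dist (sqPos d + ξ d) c = r}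
      ⊆ (fun ξ : ℤ × ℤ → ℂ => ((ξ v, ξ b, ξ d), ξ e)) ⁻¹' (G ⁻¹' {0}) := by
    rintro ξ ⟨c, r, h1, h2, h3, h4⟩
    exact cyc_eq_zero_of_concyclic h1 h2 h3 h4
  refine measure_mono_null hsub ?_
  -- Step 2: independence of `ξ e` from `(ξ v, ξ b, ξ d)` gives a product law
  have hind := indepFun_three_one hve hbe hde
  have hprod : Measure.map (fun ξ : ℤ × ℤ → ℂ => ((ξ v, ξ b, ξ d), ξ e))
        (Measure.infinitePi (fun _ : ℤ × ℤ => jitterLaw))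
      = (Measure.map (fun ξ : ℤ × ℤ → ℂ => (ξ v, ξ b, ξ d))
          (Measure.infinitePi (fun _ : ℤ × ℤ => jitterLaw))).prod jitterLaw := by
    have h := (indepFun_iff_map_prod_eq_prod_map_map hY.aemeasurable hX.aemeasurable).1 hind
    rw [Measure.infinitePi_map_eval] at h
    exact h
  rw [← Measure.map_apply hF hs, hprod]
  -- Step 3: Fubini; almost every section is a circle, hence `jitterLaw`-null
  refine Measure.measure_prod_null_of_ae_null hs ?_
  have hK : ∀ᵐ y ∂(Measure.map (fun ξ : ℤ × ℤ → ℂ => (ξ v, ξ b, ξ d))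
      (Measure.infinitePi (fun _ : ℤ × ℤ => jitterLaw))),
      y ∈ closedBall (0 : ℂ) jitterRadius ×ˢ
        (closedBall (0 : ℂ) jitterRadius ×ˢ closedBall (0 : ℂ) jitterRadius) := by
    refine (ae_map_iff hY.aemeasurable ?_).2 ?_
    · exact measurableSet_closedBall.prod (measurableSet_closedBall.prod measurableSet_closedBall)
    · filter_upwards [ae_jitter_mem v, ae_jitter_mem b, ae_jitter_mem d] with ξ h1 h2 h3
      exact Set.mk_mem_prod h1 (Set.mk_mem_prod h2 h3)
  filter_upwards [hK] with y hy
  have hk : kA[sqPos v + y.1, sqPos b + y.2.1, sqPos d + y.2.2] ≠ 0 := by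
    rw [hsb, hsd]
    exact kA_ne_zero (mem_closedBall_zero_iff.1 hy.1) (mem_closedBall_zero_iff.1 hy.2.1)
      (mem_closedBall_zero_iff.1 hy.2.2)
  show jitterLaw {z : ℂ | cyc[sqPos v + y.1, sqPos b + y.2.1, sqPos e + z, sqPos d + y.2.2] = 0}
    = 0
  exact jitterLaw_form_null hk (sqPos e)

end Summit.CriticalPhenomena.CardyFormulaZ2.Cruxes.SquareFromVoronoiHub.ProductLeg

end
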